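import Summits.AtomisticToContinuum.FouriersLaw.Theorems.PhononMeanFreePathIncoherentChannelTimeReversal
import Summits.AtomisticToContinuum.FouriersLaw.Theorems.PhononMeanFreePathIncoherentChannelReflection
import Summits.AtomisticToContinuum.FouriersLaw.Theorems.PhononMeanFreePathIncoherentChannelSquareTail
import Summits.AtomisticToContinuum.FouriersLaw.Theorems.PhononMeanFreePathKuboFormFouriersLaw
import Summits.AtomisticToContinuum.FouriersLaw.Theorems.IncoherentChannel.Negative.LoadBearing

/-!
# The coherent channel is the overlap of the two end forecasts: `r_N(2t)² ≤ S_N(t)²`, and the rank-2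
# by-product from a square-integrable engine (line `two-horizons-forecast-loss`, crux `IncoherentChannel`)

Assembly file of line lead c4 of crux `PhononMeanFreePath.IncoherentChannel` (stmt-AtomisticToContinuum-11811, route
`PhononMeanFreePath`, sub-problem `FouriersLaw`); census file (`--supports`), nothing here closes an item.

Setting: `P = pinnedChain ω₂ lam β γ` (`ω₂, lam, β, γ > 0`), the `(N+1)`-site chain `0..N` with both baths at `T > 0`,
`μ₀ = P.gibbsMeasure (N+1) T`, `K_t = P.transitionKernel (N+1) T T t⁺`; `v_t = fcast … N t = K_t p_N` (forecast of the far bath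
momentum), `S_N(t) = fnorm … N t = ‖v_t‖²_{L²(μ₀)}`, `r_N(t) = pairCorr … N t = ⟨p_0, v_t⟩_{μ₀}` (`Theorems/PhononMeanFreePathDefs`).

Three landed inputs are combined:
* time reversal (`…TimeReversal`, p138456): kernel detailed balance `K_s* = ΘK_sΘ` and Chapman–Kolmogorov give
  `r_N(s+u) = −⟨v_u∘Θ, K_s p_0⟩_{μ₀}`, hence `r_N(s+u)² ≤ S_N(u)·‖K_s p_0‖²` (`pairCorr_sq_le_fnorm_mul_leftNorm`);
* reflection (`…Reflection`, p138752): the left forecast has the norm of the right one, `‖K_s p_0‖² = S_N(s)`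
  (`leftForecastNorm_eq_fnorm`);
* the square-tail composition (`…SquareTail`, p139163): GIVEN `r_N(2t)² ≤ S_N(t)²`, the light cone plus a square tail
  `N∫_{t>N^η} S_N(t/2)² → 0` (or an envelope `S_N ≤ C(1+t)^{−α}` with `α > 1`) close the coherent channel.

Results:
* `pairCorr_sq_two_mul_le_fnorm_sq` — **`r_N(2t)² ≤ S_N(t)²`** for every `N ≥ 1`, `t ≥ 0`: the route's coherent (Landauer)
  channel at time `2t` is the `L²(μ₀)`-overlap of the momentum-flipped LEFT forecast and the RIGHT forecast at time `t`, so it is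
  QUADRATICALLY small in the forecast norm (the fixed-`N` dictionary only gave `r_N² ≤ T·S_N`, `stub_commonPastBound`);
* `coherent_of_fnormSqTail` — at one parameter point, a square tail of the forecast norm closes the coherent channel;
* `coherentDephasing_of_forecastLoss_sq` — **the rank-2 crux `CoherentDephasing` (stmt-AtomisticToContinuum-11810) BY NAME from an
  `N`-uniform envelope `S_N(t) ≤ C(1+t)^{−α}` with `α > 1`** (the registered engine `stub_forecastLoss` asks `α > 2`; what the
  engine must deliver for the rank-2 crux is halved — square-integrability with margin instead of integrability with margin);
* `incoherentChannel_iff_fouriersLaw_of_forecastLoss_sq` — under the same weaker engine the crux IS the conjunct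
  (`LoadBearing.incoherentChannel_iff_fouriersLaw` over the proved siblings `NessUnique_holds`, `boundaryKubo_proof`).
For THIS crux the common-past term `P_N = Cov(p_0², v_t²)` still enters through the Hölder bound `|P_N| ≤ K_θ S_N^θ`, `θ < 1`
(`stub_commonPastBound`), so the composition `incoherentChannel_of_forecastTail_of_varianceLimit` keeps its `θ`-tail; only the
coherent half is upgraded here. No definition, no `sorry`, axioms standard.
-/

noncomputable section

namespace Summit.AtomisticToContinuum.FouriersLaw.Theorems.PhononMeanFreePath

open MeasureTheory Set Filter Topology
open scoped NNReal
open Literature.MathematicalPhysics.KineticTheory.HeatConduction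
open Summit.AtomisticToContinuum.FouriersLaw.Theses.PhononMeanFreePath (IncoherentChannel CoherentDephasing NessUnique_holds)
open Summit.AtomisticToContinuum.FouriersLaw.Theorems.PhononMeanFreePathBoundaryKubo (boundaryKubo_proof)

/-- **The coherent channel is quadratically small in the forecast norm: `r_N(2t)² ≤ S_N(t)²`** for all parameters `> 0`,
`T > 0`, every `N ≥ 1` and `t ≥ 0`. Proof: `r_N(t+t)² ≤ S_N(t)·‖K_t p_0‖²_{L²(μ₀)}` (time reversal + Cauchy–Schwarz,
`pairCorr_sq_le_fnorm_mul_leftNorm`) and `‖K_t p_0‖² = S_N(t)` (left–right reflection, `leftForecastNorm_eq_fnorm`). [folklore] -/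
theorem pairCorr_sq_two_mul_le_fnorm_sq : ∀ ω₂ lam β γ : ℝ, 0 < ω₂ → 0 < lam → 0 < β → 0 < γ → ∀ T : ℝ, 0 < T → ∀ N : ℕ, 1 ≤ N → ∀ t : ℝ, 0 ≤ t → (pairCorr ω₂ lam β γ T N (2 * t)) ^ 2 ≤ (fnorm ω₂ lam β γ T N t) ^ 2 := by
  intro ω₂ lam β γ hω hl hβ hγ T hT N hN t ht
  have h := pairCorr_sq_le_fnorm_mul_leftNorm ω₂ lam β γ hω hl hβ hγ T hT N hN t t ht ht
  rw [leftForecastNorm_eq_fnorm ω₂ lam β γ hω hl.le hβ.le hγ.le T N t, ← two_mul] at h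
  rw [sq (fnorm ω₂ lam β γ T N t)]
  exact h

/-- **A square tail of the forecast norm closes the coherent channel** (one parameter point, all parameters `> 0`): if for
some `η ∈ (0,1)` the functions `t ↦ S_N(t/2)²` are integrable on `(0,∞)` and `N·∫_{t>N^η} S_N(t/2)² dt → 0`, then `r_N²` is
integrable on `(0,∞)` for every `N` and `N·∫₀^∞ r_N² → 0` (`coherent_of_sqTail` with its time-reversal hypothesis discharged
by `pairCorr_sq_two_mul_le_fnorm_sq`). [folklore] -/
theorem coherent_of_fnormSqTail {ω₂ lam β γ T : ℝ} (hω : 0 < ω₂) (hl : 0 < lam) (hβ : 0 < β) (hγ : 0 < γ) (hT : 0 < T)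
    (htail : ∃ η : ℝ, 0 < η ∧ η < 1 ∧
      (∀ N : ℕ, IntegrableOn (fun t => (fnorm ω₂ lam β γ T N (t / 2)) ^ 2) (Ioi (0 : ℝ))) ∧
      Tendsto (fun N : ℕ => (N : ℝ) * ∫ t in Ioi ((N : ℝ) ^ η), (fnorm ω₂ lam β γ T N (t / 2)) ^ 2) atTop (𝓝 0)) :
    (∀ N : ℕ, IntegrableOn (fun t => (pairCorr ω₂ lam β γ T N t) ^ 2) (Ioi (0 : ℝ))) ∧
    Tendsto (fun N : ℕ => (N : ℝ) * ∫ t in Ioi (0 : ℝ), (pairCorr ω₂ lam β γ T N t) ^ 2) atTop (𝓝 0) :=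
  coherent_of_sqTail ω₂ lam β γ hω hl hβ hγ T hT
    (fun N hN t ht => pairCorr_sq_two_mul_le_fnorm_sq ω₂ lam β γ hω hl hβ hγ T hT N hN t ht) htail

/-- **The rank-2 crux `CoherentDephasing` (stmt-AtomisticToContinuum-11810) BY NAME from a SQUARE-INTEGRABLE engine**: an
`N`-uniform envelope `S_N(t) ≤ C(1+t)^{−α}` with `α > 1` (for all parameters `> 0`, `T > 0`) suffices — half the exponent of the
registered engine `stub_forecastLoss` (`α > 2`, `coherentDephasing_of_forecastLoss`). CONDITIONAL on the envelope (a hypothesis,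
open: the N-uniform forecast loss is the line's engine). [folklore] -/
theorem coherentDephasing_of_forecastLoss_sq : (∀ ω₂ lam β γ : ℝ, 0 < ω₂ → 0 < lam → 0 < β → 0 < γ → ∀ T : ℝ, 0 < T → ∃ C α : ℝ, 1 < α ∧ ∀ (N : ℕ) (t : ℝ), 0 ≤ t → fnorm ω₂ lam β γ T N t ≤ C * (1 + t) ^ (-α)) → Summit.AtomisticToContinuum.FouriersLaw.Theses.PhononMeanFreePath.CoherentDephasing :=
  coherentDephasing_of_sqEnvelope pairCorr_sq_two_mul_le_fnorm_sq

/-- The registered engine (`α > 2`) is a special case of the square-integrable one (`α > 1`), so the line's landed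
`coherentDephasing_of_forecastLoss` factors through `coherentDephasing_of_forecastLoss_sq`. [folklore] -/
theorem forecastLoss_sq_of_forecastLoss
    (h₁ : ∀ ω₂ lam β γ : ℝ, 0 < ω₂ → 0 < lam → 0 < β → 0 < γ → ∀ T : ℝ, 0 < T →
      ∃ C α : ℝ, 2 < α ∧ ∀ (N : ℕ) (t : ℝ), 0 ≤ t → fnorm ω₂ lam β γ T N t ≤ C * (1 + t) ^ (-α)) :
    ∀ ω₂ lam β γ : ℝ, 0 < ω₂ → 0 < lam → 0 < β → 0 < γ → ∀ T : ℝ, 0 < T →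
      ∃ C α : ℝ, 1 < α ∧ ∀ (N : ℕ) (t : ℝ), 0 ≤ t → fnorm ω₂ lam β γ T N t ≤ C * (1 + t) ^ (-α) := by
  intro ω₂ lam β γ hω hl hβ hγ T hT
  obtain ⟨C, α, hα, h⟩ := h₁ ω₂ lam β γ hω hl hβ hγ T hT
  exact ⟨C, α, by linarith, h⟩

/-- **Under the square-integrable engine alone, the crux IS the conjunct**: an `N`-uniform envelope `S_N ≤ C(1+t)^{−α}` with
`α > 1` gives `CoherentDephasing` (`coherentDephasing_of_forecastLoss_sq`), and then the landed Negative lemma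
`LoadBearing.incoherentChannel_iff_fouriersLaw` over the proved siblings `NessUnique_holds`, `boundaryKubo_proof` identifies
`IncoherentChannel` with `FouriersLaw` (cf. `incoherentChannel_iff_fouriersLaw_of_forecastLoss`, which needed `α > 2`).
CONDITIONAL on the envelope. [folklore] -/
theorem incoherentChannel_iff_fouriersLaw_of_forecastLoss_sq
    (h₁ : ∀ ω₂ lam β γ : ℝ, 0 < ω₂ → 0 < lam → 0 < β → 0 < γ → ∀ T : ℝ, 0 < T →
      ∃ C α : ℝ, 1 < α ∧ ∀ (N : ℕ) (t : ℝ), 0 ≤ t → fnorm ω₂ lam β γ T N t ≤ C * (1 + t) ^ (-α)) :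
    IncoherentChannel ↔ _root_.FouriersLaw :=
  Summit.AtomisticToContinuum.FouriersLaw.Theorems.IncoherentChannel.Negative.LoadBearing.incoherentChannel_iff_fouriersLaw
    NessUnique_holds boundaryKubo_proof (coherentDephasing_of_forecastLoss_sq h₁)

end Summit.AtomisticToContinuum.FouriersLaw.Theorems.PhononMeanFreePath

end
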